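import Summits.BirchSwinnertonDyer.BirchSwinnertonDyer.Theorems.GoldfeldGoodTwistsLocalTwo
import Summits.BirchSwinnertonDyer.BirchSwinnertonDyer.Theorems.GoldfeldGoodTwistsDensity
import Summits.BirchSwinnertonDyer.Rank1Residual.X12.CMSmallPrimePConverse
import Summits.BirchSwinnertonDyer.BirchSwinnertonDyer.Theorems.Rank1ResidualIntModelReduction
import Literature.NumberTheory.EllipticCurves.BSDSelmerCMPConverseGoldfeldProofs
import Literature.NumberTheory.EllipticCurves.BSDSelmerSmithProofs
import Literature.NumberTheory.EllipticCurves.CyclotomicIwasawaMainTheoremIrreducibleBaseChangeProofs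
import Literature.NumberTheory.EllipticCurves.HeegnerPointsKolyvaginExceptionalTwistProofs
import Literature.NumberTheory.EllipticCurves.ComplexMultiplicationTwistIsogenyProofs
import Literature.NumberTheory.EllipticCurves.ComplexMultiplicationHasCMProofs
import Literature.NumberTheory.EllipticCurves.DeuringSupersingularReductionHoldsProofs
import Literature.NumberTheory.EllipticCurves.Rank1Residual.X11RankOneCertificates.Minimality
import Literature.NumberTheory.EllipticCurves.PointCountEulerCriterion
import Literature.NumberTheory.EllipticCurves.OrdinaryPrimesProofs
import Literature.NumberTheory.EllipticCurves.BSDInvariantsProofs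
import Literature.NumberTheory.EllipticCurves.LFunctionSmulProofs
import HarnessLib

/-!
# Rank BSD for `100 %` of the good quadratic twists of `X₀(49)`

Cell `bsd-goldfeld` (planner seat), file 3 of 3: the assembly (file 1 `GoldfeldGoodTwistsLocalTwo`
= local analysis at `2`; file 2 `GoldfeldGoodTwistsDensity` = density bookkeeping in the family `𝓕`).
Theorems only — no named fact, no axiom, no definition. HONEST FRAMING: every deep input is one of
the tree's NAMED FACTS, carried as an explicit hypothesis; what is proved here is the assembly and
all of its glue (model transport, the case split by Selmer corank, the kernel certificate of `49a1`).

**Object.** `E₀ = X₀(49) = 49a1 = [1, −1, 0, −2, −1]` (`cm7`; CM by `ℤ[(1+√−7)/2]`, `j = −3375`,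
`Δ = −7³`, good ORDINARY reduction at `2`: `a_2 = 1`), and its quadratic twists `E₀^{(d)}` by the
family `𝓕 = {d squarefree : d ≡ 1 (mod 4)}` — exactly the squarefree `d` for which `ℚ(√d)/ℚ` is
unramified at `2`, so that `E₀^{(d)}` again has good ordinary reduction at `2`.

**Main statements.**

* `analyticRank_eq_mordellWeilRank_quadraticTwist_of_selmerCorankTwoInfty_le_one` — RANK BSD FOR
  ONE GOOD TWIST: `W` globally minimal, CM, good ordinary at `2`; `d ≠ 0`, `d ≡ 1 (mod 4)`,
  `r = corank_{ℤ_2} Sel_{2^∞}(W^{(d)}/ℚ) ≤ 1` ⟹ `ord_{s=1} L(W^{(d)}, s) = rank W^{(d)}(ℚ) = r` and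
  `Ш(W^{(d)}/ℚ)` finite. Corank `0`: Burungale–Tian's rank-zero `2`-converse for CM curves (`hBT`)
  and Gross–Zagier–Kolyvagin (`hGZK`). Corank `1`: the tree's CM rank-one `2`-converse at `p = 2`
  `Summit.BirchSwinnertonDyer.Rank1Residual.X12.rank_eq_one_and_finite_sha_of_goodOrd_two`
  (Burungale–Castella–Skinner–Tian Thm. A at `p = 2`, the conductor hypothesis discharged for the
  `ℚ(√−7)`-curves, Deuring PROVED: `deuring_not_hasUnitRootAt_of_hasCM_of_not_cmSplit_holds`),
  applied to the minimal model `W'` of `W^{(d)}` (good ordinary at `2` by file 1's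
  `hasGoodReductionAtPrime_and_frobeniusTrace_of_smul_eq_quadraticTwist_two`) and transported along
  `C` (`analyticRank_smul`, `mordellWeilRank_variableChange_holds`, `shaEquiv`).
* `twistDensity_bsdRank_of_emod_four_eq_one` / `tendsto_bsdRank` — DENSITY: with
  Smith's distribution theorem for `W` (`hS : smith_selmerCorank_density W`, arXiv:2503.17619
  Thm. 1.1: corank `≥ 2` has density `0`), rank BSD (and finiteness of `Ш`) holds for a set of
  `d ∈ 𝓕` of RELATIVE DENSITY ONE in `𝓕` (and the implication "`d ∈ 𝓕 ⟹` rank BSD for `W^{(d)}`"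
  has density one among all squarefree `d`). Bookkeeping (file 2): `𝓕` has positive lower density,
  so Smith's density-`0` exceptional set stays negligible inside `𝓕`
  (`tendsto_familyProportion_one_of_twistDensity_zero`).
* `bsdRank_densityOne_twists_of_X049` — THE CASE `E₀ = 49a1`: global minimality
  (`isGloballyMinimal_cm7`, `|Δ| = 343 < 2¹²`), `a_2(E₀) = 1` (`frobeniusTrace_cm7_two`, kernel point
  count `#Ẽ₀(𝔽_2) = 2`), good reduction at `2`, CM (`hasCM_of_j_eq_neg3375`); hence, assuming
  `smith_selmerCorank_density cm7`, `hBT`, `hA`, `hGZK`: for `100 %` of `d ∈ 𝓕`,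
  `ord_{s=1} L(E₀^{(d)}, s) = rank E₀^{(d)}(ℚ)` and `Ш(E₀^{(d)}/ℚ)` is finite.

**Hypotheses ledger** (named facts of the tree, statement-only there, hypotheses here):
`smith_selmerCorank_density W` (Smith 2025, Thm. 1.1; the tree proves it from [Smi22a] Thm. 1.2,
Thm. 1.17 IV/V, Modularity and Monsky: `smith_selmerCorank_density_holds_of`);
`burungaleTian_analyticRank_eq_zero_of_selmerCorank_eq_zero_of_hasCM` (Burungale–Tian, Ann. of
Math. 203 (2026), Thm. 1.1); `BurungaleCastellaSkinnerTian2022.thmA_analyticRank_eq_one_of_selmerCorank_eq_one`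
(BCST 2022, Thm. A — SCOPE CAVEAT recorded by the cell's literature seat (`HYPOTHESIS-TABLE.md`):
Thm. A is stated for all primes, but at `p = 2` its printed proof cites odd-`p` inputs at three
steps; the `p = 2` case is asserted in print (Burungale–Skinner App. A Thm. 10.3, Li–Tian–Yan–Zhu
2025) — the tree carries Thm. A as a NAMED FACT and so does this file, as the hypothesis `hA`);
`rank_eq_analyticRank_of_analyticRank_le_one` (Gross–Zagier–Kolyvagin).
NOT needed (decided during the cell's inventory, see the cell's `REF-P2-AUDIT.md`): a restriction
`gcd(d, 7) = 1` (the conductor hypothesis of BCST Thm. A is discharged by the tree for every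
`ℚ(√−7)`-curve: `X12.differentExactlyDividesHeckeConductor_of_cmFieldDiscrOfJ_eq_neg_seven`), an
in-class version of Smith's theorem (clause 3 restricts to `𝓕` for free), Monsky's `2`-parity.

References: A. Smith, arXiv:2503.17619 (2025), Thm. 1.1 [arXiv250317619] [SmithGoldfeld2025];
A. Burungale, Y. Tian, Ann. of Math. 203 (2026), Thm. 1.1–1.2 [BurungaleTian2026]; A. Burungale,
F. Castella, C. Skinner, Y. Tian, *`p^∞`-Selmer groups and rational points on CM elliptic curves*
(2022), Thm. A [BurungaleCastellaSkinnerTian2022]; J. Coates, Y. Li, Y. Tian, S. Zhai, Proc. LMS 110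
(2015) (quadratic twists of `X₀(49)`) [CoatesLiTianZhai2015]; J. H. Silverman, *AEC* (2009),
VII.1.3, VII.5.1, App. A Prop. 1.1 [SilvermanAEC2009]; J. E. Cremona, *Algorithms for Modular
Elliptic Curves* (label `49a1`) [Cremona2006].
-/

set_option linter.dupNamespace false
set_option autoImplicit false

noncomputable section

open scoped Classical

open Filter Topology WeierstrassCurve Literature.NumberTheory.EllipticCurves
  Literature.NumberTheory.EllipticCurves.BurungaleCastellaSkinnerTian2022

namespace Summit.BirchSwinnertonDyer.BirchSwinnertonDyer.Theorems.GoldfeldGoodTwists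

/-! ## §1 Rank BSD for one good twist -/

/-- **The rank-one half, on a model.** For `V = C • W'` elliptic with CM, `W'` globally minimal
with good ordinary reduction at `2` and `corank_{ℤ_2} Sel_{2^∞}(V/ℚ) = 1`:
`ord_{s=1} L(V, s) = rank V(ℚ) = 1` and `Ш(V/ℚ)` finite — the tree's CM rank-one `2`-converse
(`Summit.BirchSwinnertonDyer.Rank1Residual.X12.rank_eq_one_and_finite_sha_of_goodOrd_two`: Burungale–Castella–Skinner–Tian Thm. A at
`p = 2` for the `ℚ(√−7)`-curves, Deuring, Gross–Zagier–Kolyvagin) applied to `W'` and moved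
along `C` (`analyticRank_smul`, `mordellWeilRank_variableChange_holds`, `shaEquiv`). [cite: BurungaleCastellaSkinnerTian2022, Thm. A and Remark 1.2] -/
theorem analyticRank_eq_one_of_smul_eq
    (hA : thmA_analyticRank_eq_one_of_selmerCorank_eq_one)
    (hDeu : deuring_not_hasUnitRootAt_of_hasCM_of_not_cmSplit)
    (hGZK : rank_eq_analyticRank_of_analyticRank_le_one)
    (V W' : WeierstrassCurve ℚ) [V.IsElliptic] [W'.IsElliptic] [W'.IsGloballyMinimal]
    (C : VariableChange ℚ) (hC : C • W' = V) (hCM : V.HasCM)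
    (hgood : W'.HasGoodReductionAtPrime 2) (hord : ¬ (2 : ℤ) ∣ W'.frobeniusTrace 2)
    (hcorank : V.selmerCorank 2 = 1) :
    V.analyticRank = 1 ∧ V.mordellWeilRank = 1 ∧ Finite V.sha := by
  subst hC
  have hCM' : W'.HasCM := by
    have h := hasCM_variableChange (C • W') C⁻¹ hCM
    rwa [inv_smul_smul] at h
  have hcor' : W'.selmerCorank 2 = 1 := by
    rw [selmerCorank_eq_of_variableChange 2 (rfl : C • W' = C • W')]; exact hcorank
  obtain ⟨har, hrank, hsha⟩ := Summit.BirchSwinnertonDyer.Rank1Residual.X12.rank_eq_one_and_finite_sha_of_goodOrd_two hA hDeu hGZK W' hCM'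
    hgood (by exact_mod_cast hord) hcor'
  refine ⟨by rw [analyticRank_smul]; exact har, ?_, (Equiv.finite_iff (shaEquiv W' C)).mp hsha⟩
  have h := mordellWeilRank_variableChange_holds W' C
  unfold mordellWeilRank_variableChange at h
  rw [h]; exact hrank

/-- **Rank BSD for one good twist.** Let `W / ℚ` be a globally minimal elliptic curve with complex
multiplication and good ordinary reduction at `2` (`2 ∤ a_2(W)`), and let `d ≠ 0`, `d ≡ 1 (mod 4)`
with `r := corank_{ℤ_2} Sel_{2^∞}(W^{(d)}/ℚ) ≤ 1`. Then `ord_{s=1} L(W^{(d)}, s) = rank W^{(d)}(ℚ) = r`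
and `Ш(W^{(d)}/ℚ)` is finite. Corank `0`: Burungale–Tian's rank-zero `2`-converse for the CM curve
`W^{(d)}` (`hBT`), then Gross–Zagier–Kolyvagin (`hGZK`). Corank `1`: `W^{(d)}` is CM with good
ordinary reduction at `2` — its minimal model `W'` has good reduction at `2` with
`a_2(W') = ±a_2(W)` since `ℚ(√d)/ℚ` is unramified at `2`
(`hasGoodReductionAtPrime_and_frobeniusTrace_of_smul_eq_quadraticTwist_two`) — so the CM rank-one
`2`-converse at `p = 2` applies (`analyticRank_eq_one_of_smul_eq`). [cite: BurungaleTian2026, Thm. 1.1]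
[cite: BurungaleCastellaSkinnerTian2022, Thm. A and Remark 1.2] -/
theorem analyticRank_eq_mordellWeilRank_quadraticTwist_of_selmerCorankTwoInfty_le_one
    (hBT : burungaleTian_analyticRank_eq_zero_of_selmerCorank_eq_zero_of_hasCM)
    (hA : thmA_analyticRank_eq_one_of_selmerCorank_eq_one)
    (hDeu : deuring_not_hasUnitRootAt_of_hasCM_of_not_cmSplit)
    (hGZK : rank_eq_analyticRank_of_analyticRank_le_one)
    (W : WeierstrassCurve ℚ) [W.IsElliptic] [W.IsGloballyMinimal] (hCM : W.HasCM)
    (hgood : W.HasGoodReductionAtPrime 2) (hord : ¬ (2 : ℤ) ∣ W.frobeniusTrace 2)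
    {d : ℤ} (hd0 : d ≠ 0) (hd4 : d % 4 = 1)
    (hle : selmerCorankTwoInfty (W.quadraticTwist d) ≤ 1) :
    (W.quadraticTwist d).analyticRank = selmerCorankTwoInfty (W.quadraticTwist d) ∧
      (W.quadraticTwist d).mordellWeilRank = selmerCorankTwoInfty (W.quadraticTwist d) ∧
        Finite (W.quadraticTwist d).sha := by
  have hd0' : ((d : ℤ) : ℚ) ≠ 0 := by exact_mod_cast hd0
  haveI := W.isElliptic_quadraticTwist hd0'
  have hCMd : (W.quadraticTwist (d : ℚ)).HasCM := hasCM_quadraticTwist_of_hasCM W hCM hd0'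
  rcases Nat.le_one_iff_eq_zero_or_eq_one.mp hle with h0 | h1
  · -- corank `0`
    have har : (W.quadraticTwist (d : ℚ)).analyticRank = 0 :=
      hBT _ hCMd 2 ((selmerCorankTwoInfty_eq _).symm.trans h0)
    obtain ⟨hrank, hsha⟩ := hGZK (W.quadraticTwist (d : ℚ)) (by omega)
    exact ⟨by rw [har, h0], by rw [hrank, har, h0], hsha⟩
  · -- corank `1`
    obtain ⟨W', hW'ell, hW'min, C, hC⟩ := exists_isGloballyMinimal_smul_eq_quadraticTwist W hd0'
    obtain ⟨hgood', htr⟩ :=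
      hasGoodReductionAtPrime_and_frobeniusTrace_of_smul_eq_quadraticTwist_two W W' hd4 hC 2 rfl
        hgood
    have hord' : ¬ (2 : ℤ) ∣ W'.frobeniusTrace 2 := by
      rw [htr]
      intro h
      apply hord
      split_ifs at h
      · simpa using h
      · simpa using h
    have hcor : (W.quadraticTwist (d : ℚ)).selmerCorank 2 = 1 :=
      (selmerCorankTwoInfty_eq _).symm.trans h1
    obtain ⟨har, hrank, hsha⟩ :=
      analyticRank_eq_one_of_smul_eq hA hDeu hGZK _ W' C hC hCMd hgood' hord' hcor
    exact ⟨by rw [har, h1], by rw [hrank, h1], hsha⟩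

/-- **Rank BSD holds for `100 %` of the good quadratic twists** (absolute form). For `W` as above
and Smith's distribution theorem for `W` (`hS`, arXiv:2503.17619 Thm. 1.1): the squarefree `d`
with "`d ≡ 1 (mod 4)` ⟹ `ord_{s=1} L(W^{(d)}, s) = rank W^{(d)}(ℚ)` and `Ш(W^{(d)}/ℚ)` finite" have
density `1` among all squarefree `d` ordered by `|d|` (the exceptions lie in Smith's density-`0`
set `{corank ≥ 2}`). [cite: arXiv250317619, Thm. 1.1] [cite: BurungaleTian2026, Thm. 1.1]
[cite: BurungaleCastellaSkinnerTian2022, Thm. A] -/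
theorem twistDensity_bsdRank_of_emod_four_eq_one
    (hBT : burungaleTian_analyticRank_eq_zero_of_selmerCorank_eq_zero_of_hasCM)
    (hA : thmA_analyticRank_eq_one_of_selmerCorank_eq_one)
    (hDeu : deuring_not_hasUnitRootAt_of_hasCM_of_not_cmSplit)
    (hGZK : rank_eq_analyticRank_of_analyticRank_le_one)
    (W : WeierstrassCurve ℚ) [W.IsElliptic] [W.IsGloballyMinimal] (hCM : W.HasCM)
    (hgood : W.HasGoodReductionAtPrime 2) (hord : ¬ (2 : ℤ) ∣ W.frobeniusTrace 2)
    (hS : smith_selmerCorank_density W) :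
    twistDensity (fun d ↦ d % 4 = 1 →
      (W.quadraticTwist d).analyticRank = (W.quadraticTwist d).mordellWeilRank ∧
        Finite (W.quadraticTwist d).sha) 1 := by
  have hR := twistDensity_selmerCorankTwoInfty_le_one_of W hS
  refine (twistDensity_congr_of_one (P := fun _ ↦ True) hR fun d _ hRd ↦ ?_).1 twistDensity_true
  simp only [true_iff]
  intro hd4
  obtain ⟨har, hrank, hsha⟩ :=
    analyticRank_eq_mordellWeilRank_quadraticTwist_of_selmerCorankTwoInfty_le_one hBT hA hDeu hGZK
      W hCM hgood hord hRd.1 hd4 hRd.2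
  exact ⟨har.trans hrank.symm, hsha⟩

/-! ## §2 Assembly: rank BSD for `100 %` of the good twists -/

/-- **Rank BSD for `100 %` of the good quadratic twists of a CM curve good ordinary at `2`**
(relative form, the headline). Let `W / ℚ` be a globally minimal elliptic curve with complex
multiplication and good ordinary reduction at `2`, and assume Smith's distribution theorem for `W`
(`hS`), Burungale–Tian's rank-zero `p`-converse (`hBT`), Burungale–Castella–Skinner–Tian's Thm. A
(`hA`) and Gross–Zagier–Kolyvagin (`hGZK`). Then for a set of `d ∈ 𝓕 = {d squarefree : d ≡ 1 (mod 4)}`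
of relative density `1`: `ord_{s=1} L(W^{(d)}, s) = rank W^{(d)}(ℚ)` and `Ш(W^{(d)}/ℚ)` is finite.
The exceptional `d ∈ 𝓕` lie in Smith's density-`0` set `{corank_{ℤ_2} Sel_{2^∞}(W^{(d)}) ≥ 2}`,
negligible inside `𝓕` by `tendsto_familyProportion_one_of_twistDensity_zero`. [cite: arXiv250317619, Thm. 1.1]
[cite: BurungaleTian2026, Thm. 1.1] [cite: BurungaleCastellaSkinnerTian2022, Thm. A] -/
theorem tendsto_bsdRank
    (hBT : burungaleTian_analyticRank_eq_zero_of_selmerCorank_eq_zero_of_hasCM)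
    (hA : thmA_analyticRank_eq_one_of_selmerCorank_eq_one)
    (hGZK : rank_eq_analyticRank_of_analyticRank_le_one)
    (W : WeierstrassCurve ℚ) [W.IsElliptic] [W.IsGloballyMinimal] (hCM : W.HasCM)
    (hgood : W.HasGoodReductionAtPrime 2) (hord : ¬ (2 : ℤ) ∣ W.frobeniusTrace 2)
    (hS : smith_selmerCorank_density W) :
    Tendsto (fun X : ℕ ↦ (Nat.card {d : ℤ | Squarefree d ∧ |d| ≤ (X : ℤ) ∧ (d % 4 = 1 ∧
        ((W.quadraticTwist d).analyticRank = (W.quadraticTwist d).mordellWeilRank ∧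
          Finite (W.quadraticTwist d).sha))} : ℝ) /
      Nat.card {d : ℤ | Squarefree d ∧ |d| ≤ (X : ℤ) ∧ d % 4 = 1}) atTop (𝓝 1) := by
  have hR := twistDensity_selmerCorankTwoInfty_le_one_of W hS
  have h0 : twistDensity (fun d ↦ ¬ (d ≠ 0 ∧ selmerCorankTwoInfty (W.quadraticTwist d) ≤ 1)) 0 := by
    simpa using hR.compl
  refine tendsto_familyProportion_one_of_twistDensity_zero (h0.mono_zero fun d hd h hRd ↦ h.2 ?_)
  obtain ⟨har, hrank, hsha⟩ :=
    analyticRank_eq_mordellWeilRank_quadraticTwist_of_selmerCorankTwoInfty_le_one hBT hA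
      deuring_not_hasUnitRootAt_of_hasCM_of_not_cmSplit_holds hGZK W hCM hgood hord hRd.1 h.1 hRd.2
  exact ⟨har.trans hrank.symm, hsha⟩

/-- The same with the common value made explicit: for `100 %` of `d ∈ 𝓕`,
`ord_{s=1} L(W^{(d)}, s) = rank W^{(d)}(ℚ) = corank_{ℤ_2} Sel_{2^∞}(W^{(d)}/ℚ) ≤ 1` and `Ш(W^{(d)}/ℚ)`
is finite. [cite: arXiv250317619, Thm. 1.1] [cite: BurungaleTian2026, Thm. 1.1]
[cite: BurungaleCastellaSkinnerTian2022, Thm. A] -/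
theorem tendsto_bsdRank_eq_selmerCorankTwoInfty
    (hBT : burungaleTian_analyticRank_eq_zero_of_selmerCorank_eq_zero_of_hasCM)
    (hA : thmA_analyticRank_eq_one_of_selmerCorank_eq_one)
    (hGZK : rank_eq_analyticRank_of_analyticRank_le_one)
    (W : WeierstrassCurve ℚ) [W.IsElliptic] [W.IsGloballyMinimal] (hCM : W.HasCM)
    (hgood : W.HasGoodReductionAtPrime 2) (hord : ¬ (2 : ℤ) ∣ W.frobeniusTrace 2)
    (hS : smith_selmerCorank_density W) :
    Tendsto (fun X : ℕ ↦ (Nat.card {d : ℤ | Squarefree d ∧ |d| ≤ (X : ℤ) ∧ (d % 4 = 1 ∧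
        (selmerCorankTwoInfty (W.quadraticTwist d) ≤ 1 ∧
          (W.quadraticTwist d).analyticRank = selmerCorankTwoInfty (W.quadraticTwist d) ∧
          (W.quadraticTwist d).mordellWeilRank = selmerCorankTwoInfty (W.quadraticTwist d) ∧
          Finite (W.quadraticTwist d).sha))} : ℝ) /
      Nat.card {d : ℤ | Squarefree d ∧ |d| ≤ (X : ℤ) ∧ d % 4 = 1}) atTop (𝓝 1) := by
  have hR := twistDensity_selmerCorankTwoInfty_le_one_of W hS
  have h0 : twistDensity (fun d ↦ ¬ (d ≠ 0 ∧ selmerCorankTwoInfty (W.quadraticTwist d) ≤ 1)) 0 := by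
    simpa using hR.compl
  refine tendsto_familyProportion_one_of_twistDensity_zero (h0.mono_zero fun d hd h hRd ↦ h.2 ?_)
  exact ⟨hRd.2, analyticRank_eq_mordellWeilRank_quadraticTwist_of_selmerCorankTwoInfty_le_one hBT hA
    deuring_not_hasUnitRootAt_of_hasCM_of_not_cmSplit_holds hGZK W hCM hgood hord hRd.1 h.1 hRd.2⟩

/-! ## §3 `E₀ = X₀(49) = 49a1` -/

/-- `49a1 = [1, −1, 0, −2, −1]` (`cm7`, `j = −3375`, `Δ = −7³`) is globally minimal: no prime has
`q¹² ∣ Δ = −343`. [cite: Cremona2006, Table 1 (Cremona label 49a1)] -/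
instance isGloballyMinimal_cm7 : cm7.IsGloballyMinimal :=
  Rank1Residual.X11RankOneCertificates.isGloballyMinimal_of_int_criterion 1 (-1) 0 (-2) (-1)
    fun q hq ⟨hΔ, _⟩ ↦ by
      have hD : Rank1Residual.X11RankOneCertificates.discOf [1, -1, 0, -2, -1] = -343 := by decide +kernel
      rw [hD, dvd_neg] at hΔ
      have h1 : q ^ 12 ∣ 343 := by exact_mod_cast Int.natAbs_dvd_natAbs.mpr hΔ
      have h2 : q ^ 12 ≤ 343 := Nat.le_of_dvd (by norm_num) h1
      have h3 : 2 ^ 12 ≤ q ^ 12 := Nat.pow_le_pow_left hq.two_le 12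
      omega

/-- The integral model of `49a1` is the integer equation `[1, −1, 0, −2, −1]`. [folklore] -/
theorem integralModelInt_cm7 : integralModelInt cm7 = ⟨1, -1, 0, -2, -1⟩ :=
  Summit.BirchSwinnertonDyer.BirchSwinnertonDyer.Rank1Residual.IntModel.integralModelInt_eq_of_map_eq _ (Summit.BirchSwinnertonDyer.BirchSwinnertonDyer.Rank1Residual.IntModel.map_mk_int 1 (-1) 0 (-2) (-1))

/-- `#Ẽ₀(𝔽_2) = 2` for `49a1` (kernel count), i.e. `a_2(49a1) = 1`. [folklore] -/
theorem card_cm7_mod_two :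
    Nat.card (((⟨1, -1, 0, -2, -1⟩ : WeierstrassCurve ℤ).map (Int.castRingHom (ZMod 2))).toAffine.Point) = 2 := by
  rw [@WeierstrassCurve.natCard_point_eq_one_add_card (ZMod 2) (@ZMod.instField 2 ⟨by norm_num⟩) _ _ _
    (by decide +kernel)]
  decide +kernel

/-- `a_2(49a1) = 1`. [cite: Cremona2006, Table 1 (Cremona label 49a1)] -/
theorem frobeniusTrace_cm7_two : cm7.frobeniusTrace 2 = 1 := by
  rw [Summit.BirchSwinnertonDyer.BirchSwinnertonDyer.Rank1Residual.IntModel.frobeniusTrace_eq integralModelInt_cm7 card_cm7_mod_two]; norm_num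

/-- `49a1` has good reduction at `2` (`2 ∤ Δ_min = −343`). [cite: Cremona2006, Table 1 (Cremona label 49a1)] -/
theorem hasGoodReductionAtPrime_cm7_two : cm7.HasGoodReductionAtPrime 2 := by
  refine hasGoodReductionAtPrime_of_not_dvd cm7 2 ?_
  rw [Summit.BirchSwinnertonDyer.BirchSwinnertonDyer.Rank1Residual.IntModel.minimalDiscriminantInt_eq integralModelInt_cm7]
  simp only [WeierstrassCurve.Δ, WeierstrassCurve.b₂, WeierstrassCurve.b₄, WeierstrassCurve.b₆,
    WeierstrassCurve.b₈]
  norm_num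

/-- **Rank BSD for `100 %` of the good quadratic twists of `X₀(49)`** (absolute form). For
`E₀ = 49a1` (CM by `ℤ[(1+√−7)/2]`, good ordinary at `2`): assuming Smith's Thm. 1.1 for `E₀`,
Burungale–Tian's rank-zero `p`-converse, Burungale–Castella–Skinner–Tian's Thm. A, Deuring's
criterion and Gross–Zagier–Kolyvagin (the tree's named facts), the squarefree `d` with
"`d ≡ 1 (mod 4)` ⟹ `ord_{s=1} L(E₀^{(d)}, s) = rank E₀^{(d)}(ℚ)` and `Ш(E₀^{(d)}/ℚ)` finite" have
density `1`. [cite: arXiv250317619, Thm. 1.1] [cite: BurungaleTian2026, Thm. 1.1]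
[cite: BurungaleCastellaSkinnerTian2022, Thm. A] [cite: CoatesLiTianZhai2015, Thm. 1.1–1.2 (context)] -/
theorem twistDensity_bsdRank_X049
    (hS : smith_selmerCorank_density cm7)
    (hBT : burungaleTian_analyticRank_eq_zero_of_selmerCorank_eq_zero_of_hasCM)
    (hA : thmA_analyticRank_eq_one_of_selmerCorank_eq_one)
    (hGZK : rank_eq_analyticRank_of_analyticRank_le_one) :
    twistDensity (fun d ↦ d % 4 = 1 →
      (cm7.quadraticTwist d).analyticRank = (cm7.quadraticTwist d).mordellWeilRank ∧
        Finite (cm7.quadraticTwist d).sha) 1 :=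
  twistDensity_bsdRank_of_emod_four_eq_one hBT hA deuring_not_hasUnitRootAt_of_hasCM_of_not_cmSplit_holds
    hGZK cm7 (hasCM_of_j_eq_neg3375 cm7 j_cm7) hasGoodReductionAtPrime_cm7_two
    (by rw [frobeniusTrace_cm7_two]; norm_num) hS


/-- **Rank BSD for `100 %` of the good quadratic twists of `X₀(49)`** (the cell's target
`bsdRank_densityOne_twists_of_X049`). For `E₀ = 49a1` and the family
`𝓕 = {d squarefree : d ≡ 1 (mod 4)}` of twists good (ordinary) at `2`: assuming Smith's Thm. 1.1
for `E₀` (`hS`), Burungale–Tian's rank-zero `p`-converse (`hBT`), Burungale–Castella–Skinner–Tian's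
Thm. A (`hA`) and Gross–Zagier–Kolyvagin (`hGZK`) — the tree's named facts — the set of `d ∈ 𝓕`
with `ord_{s=1} L(E₀^{(d)}, s) = rank E₀^{(d)}(ℚ)` and `Ш(E₀^{(d)}/ℚ)` finite has relative density
`1` in `𝓕`. (`2` splits in `ℚ(√−7)`, which is why `E₀` is ordinary at `2`; Deuring's criterion
enters only through the X12 interface and is the tree's THEOREM
`deuring_not_hasUnitRootAt_of_hasCM_of_not_cmSplit_holds`, not a hypothesis.)
[cite: arXiv250317619, Thm. 1.1] [cite: BurungaleTian2026, Thm. 1.1]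
[cite: BurungaleCastellaSkinnerTian2022, Thm. A] [cite: CoatesLiTianZhai2015, Thm. 1.1 (context)] -/
theorem bsdRank_densityOne_twists_of_X049
    (hS : smith_selmerCorank_density cm7)
    (hBT : burungaleTian_analyticRank_eq_zero_of_selmerCorank_eq_zero_of_hasCM)
    (hA : thmA_analyticRank_eq_one_of_selmerCorank_eq_one)
    (hGZK : rank_eq_analyticRank_of_analyticRank_le_one) :
    Tendsto (fun X : ℕ ↦ (Nat.card {d : ℤ | Squarefree d ∧ |d| ≤ (X : ℤ) ∧ (d % 4 = 1 ∧
        ((cm7.quadraticTwist d).analyticRank = (cm7.quadraticTwist d).mordellWeilRank ∧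
          Finite (cm7.quadraticTwist d).sha))} : ℝ) /
      Nat.card {d : ℤ | Squarefree d ∧ |d| ≤ (X : ℤ) ∧ d % 4 = 1}) atTop (𝓝 1) :=
  tendsto_bsdRank hBT hA hGZK cm7 (hasCM_of_j_eq_neg3375 cm7 j_cm7)
    hasGoodReductionAtPrime_cm7_two (by rw [frobeniusTrace_cm7_two]; norm_num) hS

/-- The same for `49a1` with the common value explicit: for `100 %` of `d ∈ 𝓕`,
`ord_{s=1} L(E₀^{(d)}, s) = rank E₀^{(d)}(ℚ) = corank_{ℤ_2} Sel_{2^∞}(E₀^{(d)}/ℚ) ∈ {0, 1}` and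
`Ш(E₀^{(d)}/ℚ)` is finite. [cite: arXiv250317619, Thm. 1.1] [cite: BurungaleTian2026, Thm. 1.1]
[cite: BurungaleCastellaSkinnerTian2022, Thm. A] -/
theorem bsdRank_eq_selmerCorank_densityOne_twists_of_X049
    (hS : smith_selmerCorank_density cm7)
    (hBT : burungaleTian_analyticRank_eq_zero_of_selmerCorank_eq_zero_of_hasCM)
    (hA : thmA_analyticRank_eq_one_of_selmerCorank_eq_one)
    (hGZK : rank_eq_analyticRank_of_analyticRank_le_one) :
    Tendsto (fun X : ℕ ↦ (Nat.card {d : ℤ | Squarefree d ∧ |d| ≤ (X : ℤ) ∧ (d % 4 = 1 ∧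
        (selmerCorankTwoInfty (cm7.quadraticTwist d) ≤ 1 ∧
          (cm7.quadraticTwist d).analyticRank = selmerCorankTwoInfty (cm7.quadraticTwist d) ∧
          (cm7.quadraticTwist d).mordellWeilRank = selmerCorankTwoInfty (cm7.quadraticTwist d) ∧
          Finite (cm7.quadraticTwist d).sha))} : ℝ) /
      Nat.card {d : ℤ | Squarefree d ∧ |d| ≤ (X : ℤ) ∧ d % 4 = 1}) atTop (𝓝 1) :=
  tendsto_bsdRank_eq_selmerCorankTwoInfty hBT hA hGZK cm7 (hasCM_of_j_eq_neg3375 cm7 j_cm7)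
    hasGoodReductionAtPrime_cm7_two (by rw [frobeniusTrace_cm7_two]; norm_num) hS

end Summit.BirchSwinnertonDyer.BirchSwinnertonDyer.Theorems.GoldfeldGoodTwists

end
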